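import Summits.AtomisticToContinuum.Crystallization.Theses.PalmUnimodularRigidity
import Literature.Geometry.DiscreteGeometry.LayerStackings
import Literature.Geometry.DiscreteGeometry.DelaunaySubdivision

/-!
# Sketch — crux `ShellsToBarlowChart` (stmt-AtomisticToContinuum-9227), ideator 1, round 1

First-lemma signatures for the idea card `flat-development-to-hales`
("Delaunay truss → flat exponential map → exact tiling → Hales DSP §1.3 in tree").

* `EveryPointGood S`      : the crux hypothesis, verbatim.
* `ChartConclusion S`     : the crux conclusion, verbatim.
* `DevelopedChart`        : END-GAME (first lemma, M): an injective, 1-separated, bond-faithful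
                            development `D : S → ℝ³` with EXACT FCC/HCP distance-1 shells yields the
                            chart, by `HalesDSP_layerPackings_holds` applied to `2 • D '' S` and the
                            scaling `barlowStacking 2 (2h) s = 2 • barlowStacking 1 h s`.
* `FlatDevelopment`       : THE GLOBAL STEP (L): every-point-good `S` admits such a development
                            (Delaunay truss cells + flat exponential map from one atom).
* `shellsToBarlowChart_of`: the two compose to the crux BY NAME (proved, no sorry).
* `TwoShellControl`, `DelaunayCellsAreTrussCells` : the two local lemmas the global step rests on.
-/

namespace Summit.AtomisticToContinuum.Crystallization.Cruxes.ShellsToBarlowChart.FlatDevelopmentSketch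

open Literature.Geometry.DiscreteGeometry Literature.MathematicalPhysics.StatisticalMechanics
open scoped Classical

/-- Euclidean `3`-space. -/
local notation "E3" => EuclideanSpace ℝ (Fin 3)

/-- The crux hypothesis at one point with an explicit scale `a`. -/
def GoodShellAt (S : Set E3) (x : E3) (a : ℝ) : Prop :=
  ∃ T : Finset E3, (↑T : Set E3) = (fun y : E3 => y - x) '' {y : E3 | y ∈ S ∧ y ≠ x ∧ dist y x ≤ 5 / 4 * a} ∧
    (ShellCloseTo (a / 100) T (Finset.image (fun v : E3 => a • v) fccKissingPattern) ∨
     ShellCloseTo (a / 100) T (Finset.image (fun v : E3 => a • v) hcpKissingPattern))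

/-- The crux hypothesis, verbatim shape: every point has a `1 %`-good shell at its own scale. -/
def EveryPointGood (S : Set E3) : Prop :=
  ∀ x ∈ S, ∃ a : ℝ, 9 / 10 ≤ a ∧ a ≤ 1 ∧ GoodShellAt S x a

/-- The crux conclusion, verbatim. -/
def ChartConclusion (S : Set E3) : Prop :=
  ∃ s : ℤ → ℤ, IsHaggSeq s ∧ ∃ Φ : E3 → E3, Set.BijOn Φ (barlowStacking 1 (Real.sqrt (2 / 3)) s) S ∧
    ∀ p ∈ barlowStacking 1 (Real.sqrt (2 / 3)) s, ∀ q ∈ barlowStacking 1 (Real.sqrt (2 / 3)) s,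
      (dist p q = 1 ↔ (0 < dist (Φ p) (Φ q) ∧ dist (Φ p) (Φ q) ≤ 28 / 25))

/-- A bond of `S`: two points at distance in `(0, 28/25]` (for every-point-good `S` these are
exactly the twelve shell neighbours of either endpoint). -/
def IsBond (x y : E3) : Prop := 0 < dist x y ∧ dist x y ≤ 28 / 25

/-- What the global step must deliver: a DEVELOPMENT of `S` into `ℝ³` that is `1`-separated
(hence injective), bond-faithful (bond ↔ developed distance exactly `1`) and has EXACT FCC/HCP
distance-`1` shells. -/
def IsExactDevelopment (S : Set E3) (D : E3 → E3) : Prop :=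
  (∀ x ∈ S, ∀ y ∈ S, x ≠ y → 1 ≤ dist (D x) (D y)) ∧
  (∀ x ∈ S, ∀ y ∈ S, (IsBond x y ↔ dist (D x) (D y) = 1)) ∧
  (∀ x ∈ S, ∃ A : E3 →ₗᵢ[ℝ] E3,
      {z : E3 | z ∈ D '' S ∧ dist z (D x) = 1} = (fun p : E3 => D x + A p) '' (fccKissingPattern : Set E3) ∨
      {z : E3 | z ∈ D '' S ∧ dist z (D x) = 1} = (fun p : E3 => D x + A p) '' (hcpKissingPattern : Set E3))

/-- FIRST LEMMA (end-game, size M, provable now): an exact development yields the chart.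
Proof plan: `V := (2 • ·) '' (D '' S)` is an `IsUnitBallPacking` with `HasFccOrHcpShells`, so
`HalesDSP_layerPackings_holds` gives `V = g '' barlowStacking 2 (2√(2/3)) s`; put
`Φ p := D⁻¹ (½ g (2 p))` and use `barlowPos 2 (2h) s k i j = 2 • barlowPos 1 h s k i j`. -/
def DevelopedChart : Prop :=
  ∀ S : Set E3, S.Nonempty → ∀ D : E3 → E3, IsExactDevelopment S D → ChartConclusion S

/-- THE GLOBAL STEP (size L): every-point-good sets admit an exact development.  Route of the card:
Delaunay cells of `S` are bond tetrahedra / bond octahedra (local), they tile `ℝ³`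
(`biUnion_convexHull_delaunayCells_of_covering`, tree), the abstract regular-cell structure is flat
at every edge (2 tet + 2 oct) and vertex (cubocta/anticubocta star), and the flat exponential map
from one atom is a bijection `ℝ³ → ℝ³` because actual space is star-shaped and has no boundary
(every point has a full star); its inverse is `D`. -/
def FlatDevelopment : Prop :=
  ∀ S : Set E3, S.Nonempty → EveryPointGood S → ∃ D : E3 → E3, IsExactDevelopment S D

/-- The two statements compose to the crux, by name. -/
theorem shellsToBarlowChart_of (hdev : FlatDevelopment) (hend : DevelopedChart) :
    Summit.AtomisticToContinuum.Crystallization.Theses.PalmUnimodularRigidity.ShellsToBarlowChart := by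
  intro S hne hgood
  have hgood' : EveryPointGood S := by
    intro x hx
    obtain ⟨a, ha1, ha2, T, hT, hclose⟩ := hgood x hx
    exact ⟨a, ha1, ha2, T, hT, hclose⟩
  obtain ⟨D, hD⟩ := hdev S hne hgood'
  exact hend S hne D hD

/-- LOCAL LEMMA 1 (two-shell control from one-shell data, size S/M): at a good point with scale
`a`, no point of `S` lies at distance in `(5a/4, 1.35 a)` — the nearest-direction neighbour
(pattern directions cover `S²` within `45°`) would otherwise be crowded inside its own hard core
`0.99 · a_y ≥ 0.97 a`.  Consequence: `S ∩ B(x, 1.5 a) ⊆ N[x] ∪ N(N(x))`, whose geometry the two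
glued shells pin to `3 %`. -/
def TwoShellControl : Prop :=
  ∀ S : Set E3, EveryPointGood S → ∀ x ∈ S, ∀ a : ℝ, 9 / 10 ≤ a → a ≤ 1 → GoodShellAt S x a →
    ∀ p ∈ S, dist p x < 27 / 20 * a → dist p x ≤ 5 / 4 * a

/-- LOCAL LEMMA 2 (Delaunay cells are truss cells, size M): every canonical Delaunay cell of an
every-point-good `S` (tree `IsDelaunayCell`: all sites on an empty sphere, affinely spanning) is a
bond tetrahedron (4-clique of bonds) or lies inside a bond octahedron (six points inducing `K₂,₂,₂`
on bonds, the three diagonals non-bonds).  Margins: tetrahedral holes have the next site at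
`≈ 1.17 a` against circumradius `0.61 a`, octahedral holes `1.22 a` against `0.71 a`. -/
def DelaunayCellsAreTrussCells : Prop :=
  ∀ S : Set E3, EveryPointGood S → ∀ t : Set E3, IsDelaunayCell S t →
    (∃ x y z w : E3, t = {x, y, z, w} ∧ IsBond x y ∧ IsBond x z ∧ IsBond x w ∧ IsBond y z ∧
        IsBond y w ∧ IsBond z w) ∨
    (∃ O : Finset E3, (↑O : Set E3) ⊆ S ∧ O.card = 6 ∧ t ⊆ ↑O ∧
        ∀ u ∈ O, (O.filter fun v => IsBond u v).card = 4 ∧ (O.filter fun v => v ≠ u ∧ ¬ IsBond u v).card = 1)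

/-- Sanity: the scaling identity the end-game uses, stated (proof: unfold `barlowPos`, `smul_add`). -/
def BarlowScaling : Prop :=
  ∀ (a h c : ℝ) (s : ℤ → ℤ) (k i j : ℤ),
    barlowPos (c * a) (c * h) s k i j = c • barlowPos a h s k i j

example : BarlowScaling := by
  intro a h c s k i j
  ext n
  fin_cases n <;>
    simp [barlowPos, triangularVec₁, triangularVec₂, barlowOffset, layerNormal, smul_eq_mul] <;> ring


/-! ## Card `distance-sweep-development` (ideator 1, card 2): discrete (D1) by a distance sweep -/

/-- `D` is EXACT ON THE STAR of `x`: recentred at `D x`, it maps the bond-neighbours of `x`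
bijectively onto a rotated copy of the unit FCC or HCP pattern. -/
def StarExact (S : Set E3) (D : E3 → E3) (x : E3) : Prop :=
  ∃ A : E3 →ₗᵢ[ℝ] E3,
    Set.BijOn (fun y : E3 => D y - D x) {y : E3 | y ∈ S ∧ IsBond x y} (A '' (fccKissingPattern : Set E3)) ∨
    Set.BijOn (fun y : E3 => D y - D x) {y : E3 | y ∈ S ∧ IsBond x y} (A '' (hcpKissingPattern : Set E3))

/-- A LOCALLY EXACT development: exact on every star (one map `D`, so adjacent stars are
automatically glued; no injectivity or separation is claimed globally). -/
def LocallyExactDevelopment (S : Set E3) (D : E3 → E3) : Prop :=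
  ∀ x ∈ S, StarExact S D x

/-- (D1, discrete) THE SWEEP: every-point-good `S` admits a locally exact development, built atom by
atom in order of distance from a base atom `v₀`; at each new atom `v` the already-developed
neighbours `P(v) = N(v) ∩ B[v₀, |v − v₀|]` form a half-space section of the link polytope, hence a
CONNECTED set of `≥ 3` pattern points (lower-cap lemma), and the exact 2-ball chart of `v` pinned on
`P(v) ∪ {v}` extends `D` to `v` consistently. -/
def SweepDevelopment : Prop :=
  ∀ S : Set E3, S.Nonempty → EveryPointGood S → ∃ D : E3 → E3, LocallyExactDevelopment S D

/-- (D2, shared with card 1) RADIAL LIFTING: a locally exact development of an every-point-good set is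
an exact development (injective, `1`-separated, bond-faithful): extend `D` affinely to the Delaunay
truss cells, lift model segments from `D v₀` back through the resulting local homeomorphism
(completeness = every point has a full star), and use that a continuous injective local section of a
local homeomorphism has clopen image. -/
def RadialLifting : Prop :=
  ∀ S : Set E3, EveryPointGood S → ∀ D : E3 → E3, LocallyExactDevelopment S D → IsExactDevelopment S D

/-- The discrete line composes to the crux, by name. -/
theorem shellsToBarlowChart_of_sweep (h1 : SweepDevelopment) (h2 : RadialLifting) (h3 : DevelopedChart) :
    Summit.AtomisticToContinuum.Crystallization.Theses.PalmUnimodularRigidity.ShellsToBarlowChart := by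
  refine shellsToBarlowChart_of ?_ h3
  intro S hne hgood
  obtain ⟨D, hD⟩ := h1 S hne hgood
  exact ⟨D, h2 S hgood D hD⟩

/-- LOWER-CAP LEMMA (finite, first checkable statement of card 2): every open half-space section
`{p : c < ⟪d, p⟫}` of the FCC or HCP unit pattern with `0 < c < ‖d‖ · cos 73.5°` (caps of angular
radius `> 73.5°`; the sweep only meets radius `≥ arccos (1/4) − 2° ≈ 73.5°`) has at least three
points and is connected in the contact graph (no proper non-empty part without a unit contact to the
rest).  Numerically verified this session over `1.4·10⁶` sampled sections incl. `±2°` sandwiches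
(capcheck.py: 122 / 171 distinct sections, 0 disconnected, min size 3). -/
def LowerCapLemma : Prop :=
  ∀ P ∈ ({fccKissingPattern, hcpKissingPattern} : Set (Finset E3)), ∀ d : E3, ∀ c : ℝ,
    0 < c → c < ‖d‖ * Real.cos (73.5 * Real.pi / 180) →
    let Q := P.filter (fun p => c < inner ℝ d p)
    3 ≤ Q.card ∧ ∀ R ⊆ Q, R.Nonempty → R ≠ Q → ∃ p ∈ R, ∃ q ∈ Q \ R, dist p q = 1

/-! ## Card `barlow-cover-orbit-count` (ideator 1, card 3): cover from the Barlow side, count orbits -/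

/-- A COMBINATORIAL BARLOW COVER of `S`: a map from an ideal Barlow stacking onto `S` carrying unit
contacts to bonds and each model star bijectively onto the actual star (a covering of `12`-regular
graphs).  Built by 2-D development of one hexagon sheet and Hales's layer-upon-layer propagation run on
the simply connected lattice side. -/
def IsBarlowCover (S : Set E3) (s : ℤ → ℤ) (π : E3 → E3) : Prop :=
  Set.MapsTo π (barlowStacking 1 (Real.sqrt (2 / 3)) s) S ∧
  Set.SurjOn π (barlowStacking 1 (Real.sqrt (2 / 3)) s) S ∧
  (∀ p ∈ barlowStacking 1 (Real.sqrt (2 / 3)) s, ∀ q ∈ barlowStacking 1 (Real.sqrt (2 / 3)) s,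
      dist p q = 1 → IsBond (π p) (π q)) ∧
  (∀ p ∈ barlowStacking 1 (Real.sqrt (2 / 3)) s,
      Set.BijOn π {q : E3 | q ∈ barlowStacking 1 (Real.sqrt (2 / 3)) s ∧ dist p q = 1}
        {y : E3 | y ∈ S ∧ IsBond (π p) y})

/-- (D1') existence of the cover. -/
def BarlowCover : Prop :=
  ∀ S : Set E3, S.Nonempty → EveryPointGood S → ∃ s : ℤ → ℤ, IsHaggSeq s ∧ ∃ π : E3 → E3, IsBarlowCover S s π

/-- (D2') ORBIT VOLUME COUNT (first lemma of card 3): a Barlow cover of an every-point-good set is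
injective.  A coincidence `π p̃ = π p̃'` yields, by lifting actual paths through the cell-wise
extension of `π`, a fixed-point-free Euclidean symmetry `g` of the model tiling with `π ∘ g = π`;
near its axis of minimal displacement `d₀` the `N = ⌊R/d₀⌋` translates of the lift of every actual
cell in `B(q, 0.88 R)` sit in the `R`-neighbourhood of an orbit segment of length `≤ R` (volume
`≤ 7.4 R³`, so `≤ 63 R³` unit cells), against `≥ 5.8 R³` actual cells: `N ≤ 11` for every `R`. -/
def CoverInjective : Prop :=
  ∀ S : Set E3, EveryPointGood S → ∀ s : ℤ → ℤ, IsHaggSeq s → ∀ π : E3 → E3, IsBarlowCover S s π →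
    Set.InjOn π (barlowStacking 1 (Real.sqrt (2 / 3)) s)

/-- The combinatorial line composes to the crux, by name (an injective cover IS the chart). -/
theorem shellsToBarlowChart_of_cover (h1 : BarlowCover) (h2 : CoverInjective) :
    Summit.AtomisticToContinuum.Crystallization.Theses.PalmUnimodularRigidity.ShellsToBarlowChart := by
  intro S hne hgood
  have hgood' : EveryPointGood S := by
    intro x hx
    obtain ⟨a, ha1, ha2, T, hT, hclose⟩ := hgood x hx
    exact ⟨a, ha1, ha2, T, hT, hclose⟩
  obtain ⟨s, hs, π, hπ⟩ := h1 S hne hgood'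
  have hinj := h2 S hgood' s hs π hπ
  obtain ⟨hmaps, hsurj, hbond, hstar⟩ := hπ
  refine ⟨s, hs, π, ⟨hmaps, hinj, hsurj⟩, ?_⟩
  intro p hp q hq
  constructor
  · intro hpq
    exact hbond p hp q hq hpq
  · intro hb
    have hy : π q ∈ {y : E3 | y ∈ S ∧ IsBond (π p) y} := ⟨hmaps hq, hb⟩
    obtain ⟨q', ⟨hq'B, hq'd⟩, hq'eq⟩ := (hstar p hp).surjOn hy
    have : q' = q := hinj hq'B hq hq'eq
    rw [← this]; exact hq'd

end Summit.AtomisticToContinuum.Crystallization.Cruxes.ShellsToBarlowChart.FlatDevelopmentSketch
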